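import Summits.CriticalPhenomena.PercolationContinuityZ3.Theorems.PercNearOneGluingNoHeavyLowerTailAnchoredExchange
import HarnessLib

/-!
# `NoHeavyLowerTail` (stmt-CriticalPhenomena-4575) — the ANCHORED pair-gain exchange: ranking before a block is glued,
# the weaker endpoint of a glued pair still gains at least as much as the block

Support file (lemma factory `prim-lf-3` gen 7, seat g9; `--supports stmt-CriticalPhenomena-4575`).  No definitions, no named
facts, no sorries.  Memo: `run/shared/lean/prim/prim-lf-3/LF3-BETA-R.md` §12–13.

Setting: weights `w` on the pairs of `Fin n`, a block `S` glued afterwards (`glue_S w` = weight `1` on every non-loop pair inside `S`),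
`s₀ ∈ S`, vertices `b, p, p'`.  If `μ_w(p ↔ b) ≤ μ_w(p' ↔ b)` in the UNGLUED graph, then in the glued graph

  `μ_{glue_S w}(p ↔ b, p' ↮ b, p' ↔ s₀) ≤ μ_{glue_S w}(p' ↔ b, p ↮ b, p ↮ s₀)`            (`pairGain_exchange_glued`),

i.e. the gain of `p` from the sure bond `pp'` dominates the gain of the glued block `[S]`, although the ranking `p ≤ p'` may be destroyed
by gluing `S`.  With `S = {s₀}` this is `pairGain_exchange`.  This is the ingredient that makes the `j`-free residual of the formal face
nonnegative for EVERY atom `Y` (take `S = Y`, `p = ` the `K`-weakest port of the two-port star), memo §13.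
Proof: `UpsetExchange.upsetExchange_event` with anchor `p'` and `E = {p' ↔ s₀}` (increasing in the open edge cluster of `p'` jointly
with "`S` internally open", exactly as in `anchoredExchange`), then remove the common part `{p ↔ b, p' ↔ b} ∩ E`.
-/

namespace Summit.CriticalPhenomena.PercolationContinuityZ3.Theorems

open MeasureTheory Set ProbabilityTheory
open Literature.Probability.LatticeModels
open Literature.Probability.Percolation

noncomputable section
open Classical

namespace UpsetExchange

variable {n : ℕ}

/-- **Anchored pair-gain exchange.**  See the module docstring. [cite: KozmaNitzan2024, Lemma 3(i) (p. 6), Lemma 5 (p. 13);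
VandenbergHaggstromKahn2005, Thm. 1.3] -/
theorem pairGain_exchange_glued (w : Sym2 (Fin n) → unitInterval) (S : Finset (Fin n)) (p p' b s₀ : Fin n)
    (hs₀ : s₀ ∈ S)
    (hyp : (prodBernoulli w).real (openConn p b) ≤ (prodBernoulli w).real (openConn p' b)) :
    (prodBernoulli (fun e : Sym2 (Fin n) => if (∀ x ∈ e, x ∈ S) ∧ ¬ e.IsDiag then 1 else w e)).real
        (openConn p b ∩ (openConn p' b)ᶜ ∩ openConn p' s₀) ≤
      (prodBernoulli (fun e : Sym2 (Fin n) => if (∀ x ∈ e, x ∈ S) ∧ ¬ e.IsDiag then 1 else w e)).real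
        (openConn p' b ∩ (openConn p b)ᶜ ∩ (openConn p s₀)ᶜ) := by
  set g : Sym2 (Fin n) → unitInterval := fun e => if (∀ x ∈ e, x ∈ S) ∧ ¬ e.IsDiag then 1 else w e with hg
  set E : Set (BondConfig (Fin n)) := openConn p' s₀ with hEdef
  -- `E` is increasing in the open edge cluster of the anchor `p'`, jointly with `S` internally open
  have hE : ∀ ω ω' : BondConfig (Fin n), ω ∈ E →
      (∀ e : Sym2 (Fin n), (∀ x ∈ e, x ∈ S) → ¬ e.IsDiag → e ∈ ω) →
      openEdgeCluster ω p' ⊆ openEdgeCluster ω' p' →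
      ω' ∈ E ∧ ∀ e : Sym2 (Fin n), (∀ x ∈ e, x ∈ S) → ¬ e.IsDiag → e ∈ ω' := by
    intro ω ω' hω hF hsub
    have key := mem_openEdgeCluster_of_open_mem S s₀ hs₀ ω hF
    have has : (openGraph ω).Reachable p' s₀ := hω
    have hclus : openEdgeCluster ω s₀ ⊆ openEdgeCluster ω p' := by
      intro e he
      rw [mem_openEdgeCluster_iff] at he ⊢
      exact ⟨he.1, he.2.1, fun x hx => has.trans (he.2.2 x hx)⟩
    refine ⟨?_, fun e heS hed => ?_⟩
    · have has' : (openGraph ω').Reachable p' s₀ := by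
        rw [reachable_iff_exists_mem_openEdgeCluster] at has ⊢
        rcases has with h | ⟨e, he, hse⟩
        · exact Or.inl h
        · exact Or.inr ⟨e, hsub he, hse⟩
      exact has'
    · have heω : e ∈ ω := hF e heS hed
      have hSne : ∃ x ∈ e, x ∈ S := by
        induction e using Sym2.ind with
        | h x y => exact ⟨x, Sym2.mem_mk_left x y, heS x (Sym2.mem_mk_left x y)⟩
      exact openEdgeCluster_subset ω' p' (hsub (hclus (key.2 e heω hed hSne)))
  have hx := upsetExchange_event w S p b p' E hE hyp
  -- remove the common part `{p ↔ b} ∩ {p' ↔ b} ∩ E`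
  have hmeas : ∀ X : Set (BondConfig (Fin n)), MeasurableSet X := fun _ => MeasurableSet.of_discrete
  have hL := measureReal_inter_add_sdiff (μ := prodBernoulli g) (s := openConn p b ∩ E) (hmeas (openConn p' b))
    (measure_ne_top _ _)
  have hR := measureReal_inter_add_sdiff (μ := prodBernoulli g) (s := openConn p' b ∩ E) (hmeas (openConn p b))
    (measure_ne_top _ _)
  have hZ : openConn p b ∩ E ∩ openConn p' b = openConn p' b ∩ E ∩ openConn p b := by
    ext ω; simp only [mem_inter_iff]; tauto
  have h1 : (openConn p b ∩ E) \ openConn p' b = openConn p b ∩ (openConn p' b)ᶜ ∩ openConn p' s₀ := by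
    ext ω; simp only [hEdef, mem_sdiff, mem_inter_iff, mem_compl_iff]; tauto
  have h2 : (prodBernoulli g).real ((openConn p' b ∩ E) \ openConn p b) ≤
      (prodBernoulli g).real (openConn p' b ∩ (openConn p b)ᶜ ∩ (openConn p s₀)ᶜ) := by
    apply measureReal_mono
    · rintro ω ⟨⟨hp'b, hp's⟩, hpb⟩
      refine ⟨⟨hp'b, hpb⟩, fun hps => hpb ?_⟩
      exact ((hps : (openGraph ω).Reachable p s₀).trans (hp's : (openGraph ω).Reachable p' s₀).symm).trans
        (hp'b : (openGraph ω).Reachable p' b)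
    · exact measure_ne_top _ _
  rw [hZ] at hL
  rw [← h1]
  linarith

end UpsetExchange

end

end Summit.CriticalPhenomena.PercolationContinuityZ3.Theorems
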